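import Mathlib
import Literature.NumberTheory.Transcendental.KZRulesAssociator
import Literature.NumberTheory.Transcendental.KZProductIdeal
import Literature.NumberTheory.Transcendental.KZGaussMultiplicationChain
import Literature.NumberTheory.Transcendental.KZSemiCanonicalReductionProofs
import Literature.NumberTheory.Transcendental.KZBallVolume
import Summits.KontsevichZagierPeriods.KontsevichZagierPeriods.Theorems.HyperbolicBlochOffTetraSectorKernelStubChudnovskyRing
import Summits.KontsevichZagierPeriods.KontsevichZagierPeriods.Theorems.MzvKernelInKZ.Negative.PiLine
import Summits.KontsevichZagierPeriods.KontsevichZagierPeriods.Theorems.CompiledSubstitutionsPiNormalisation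
import Summits.KontsevichZagierPeriods.KontsevichZagierPeriods.Theorems.TerasomaMultiplicationGammaHodgeFromRelatorsChains
import Summits.KontsevichZagierPeriods.KontsevichZagierPeriods.Theorems.GenusOneIteratedLegendreLemniscaticBetaUnit

/-!
# Stub `stub_legendreRing` — crux `OffTetraSectorKernel`, line `odd-hyperbolic-ladder` (skeleton v8, lead c6)

CONJECTURE 1 HOLDS ON THE LEGENDRE RING — THE CIRCLE AND BOTH LEMNISCATIC PERIODS; ITS ONLY RELATION IS LEGENDRE'S. The
subring of the formal period ring `P = FormalRep ⧸ relations` generated by the algebraic points, the arctangent carriers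
`⟦A⟧` (value `π/4`) and Euler's Beta carriers `⟦β(¼,½)⟧`, `⟦β(¾,½)⟧` (values `B(¼,½) = 2ϖ₀` and `B(¾,½) = 2π/ϖ₀`, the
lemniscatic periods of the first and second kind) is NOT a polynomial ring: EULER–LEGENDRE's relation
`B(¼,½)·B(¾,½) = 4π` holds, and it holds INSIDE the calculus — `⟦β(¼,½)⟧·⟦β(¾,½)⟧ = 16·⟦A⟧` in `P`
(`legendre_relation_P`: Dirichlet's re-association `β(¼,½)β(¾,½) = β(½,½)β(¼,1)` of route TerasomaMultiplication,
`β(½,½) = ⟦disc⟧ = 4⟦A⟧` of Kontsevich–Zagier's first example, `β(¼,1) = 4` by one Newton–Leibniz move of route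
GenusOneIterated). THEOREM (`stub_legendreRing`): on that subring `evalP x = 0 → x = 0` all the same — every element is
`p(⟦A⟧, ⟦β(¼,½)⟧, ⟦β(¾,½)⟧)`, `p ∈ K[X₀,X₁,X₂]`; `X₀ − X₁X₂/16` divides `p − p(X₁X₂/16, X₁, X₂)` and is KILLED in `P` by
Legendre's relation, while `p(X₁X₂/16, X₁, X₂)` is governed by CHUDNOVSKY: `B(¼,½)` and `B(¾,½) = 4π/B(¼,½)` are
algebraically independent (`legendre_algebraicIndependent`, from `chudnovsky_pi_beta`). So the kernel of `K[X] → ℝ` is the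
principal ideal of Legendre's relation and Conjecture 1 holds on the Legendre ring: the first closed sector of the residue with
a NON-TRIVIAL relation.

References: L. Euler (1782), A.-M. Legendre (1811); G. V. Chudnovsky (1984), Ch. 7; M. Kontsevich, D. Zagier, *Periods* (2001), §1.2, §4.1.
-/

noncomputable section

open Set MeasureTheory
open Literature.NumberTheory.Transcendental

namespace Summit.KontsevichZagierPeriods.HyperbolicBloch.OffTetraSectorKernel

/-! ## Division by `X₀ − w₀` -/

/-- If a substitution `w` fixes every variable but `X₀`, then `X₀ − w₀` divides `p − p[w]`. [folklore] -/
theorem legendre_dvd_sub_bind₁ {σ R : Type*} [CommRing R] [DecidableEq σ] (i₀ : σ) (w : σ → MvPolynomial σ R)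
    (hw : ∀ i, i ≠ i₀ → w i = MvPolynomial.X i) (p : MvPolynomial σ R) :
    (MvPolynomial.X i₀ - w i₀) ∣ p - MvPolynomial.bind₁ w p := by
  induction p using MvPolynomial.induction_on with
  | C a => simp
  | add p q hp hq =>
    have e : p + q - MvPolynomial.bind₁ w (p + q) =
        (p - MvPolynomial.bind₁ w p) + (q - MvPolynomial.bind₁ w q) := by
      rw [map_add]; ring
    rw [e]
    exact dvd_add hp hq
  | mul_X p i hp =>
    have e : p * MvPolynomial.X i - MvPolynomial.bind₁ w (p * MvPolynomial.X i) =
        (p - MvPolynomial.bind₁ w p) * MvPolynomial.X i +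
          MvPolynomial.bind₁ w p * (MvPolynomial.X i - w i) := by
      rw [map_mul, MvPolynomial.bind₁_X_right]; ring
    rw [e]
    refine dvd_add (dvd_mul_of_dvd_left hp _) ?_
    by_cases hi : i = i₀
    · subst hi
      exact dvd_mul_left _ _
    · rw [hw i hi, sub_self, mul_zero]
      exact dvd_zero _

/-! ## Euler–Legendre for the values, and Chudnovsky for `(B(¼,½), B(¾,½))` -/

/-- **Euler 1782**: `B(¼,½)·B(¾,½) = 4π` (`Γ(5/4) = ¼Γ(¼)`, `Γ(½)² = π`). [folklore] -/
theorem legendre_beta_mul :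
    ProbabilityTheory.beta (((1 / 4 : ℚ)) : ℝ) (((1 / 2 : ℚ)) : ℝ) *
      ProbabilityTheory.beta (((3 / 4 : ℚ)) : ℝ) (((1 / 2 : ℚ)) : ℝ) = 4 * Real.pi := by
  have hcast1 : (((1 / 4 : ℚ)) : ℝ) = 1 / 4 := by push_cast; ring
  have hcast2 : (((1 / 2 : ℚ)) : ℝ) = 1 / 2 := by push_cast; ring
  have hcast3 : (((3 / 4 : ℚ)) : ℝ) = 3 / 4 := by push_cast; ring
  rw [hcast1, hcast2, hcast3, ProbabilityTheory.beta, ProbabilityTheory.beta,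
    show (1 : ℝ) / 4 + 1 / 2 = 3 / 4 by norm_num, show (3 : ℝ) / 4 + 1 / 2 = 1 / 4 + 1 by norm_num,
    Real.Gamma_add_one (by norm_num : (1 : ℝ) / 4 ≠ 0), Real.Gamma_one_half_eq]
  have hg1 : Real.Gamma (1 / 4) ≠ 0 := (Real.Gamma_pos_of_pos (by norm_num)).ne'
  have hg3 : Real.Gamma (3 / 4) ≠ 0 := (Real.Gamma_pos_of_pos (by norm_num)).ne'
  have hsp : Real.sqrt Real.pi ^ 2 = Real.pi := Real.sq_sqrt Real.pi_pos.le
  field_simp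
  nlinarith [hsp]

/-- `B(¼,½) ≠ 0`. [folklore] -/
theorem legendre_beta_ne_zero : ProbabilityTheory.beta (((1 / 4 : ℚ)) : ℝ) (((1 / 2 : ℚ)) : ℝ) ≠ 0 :=
  (ProbabilityTheory.beta_pos (by norm_num) (by norm_num)).ne'

/-- **Chudnovsky for both lemniscatic periods**: `B(¼,½)` and `B(¾,½) = 4π/B(¼,½)` are algebraically independent over
`ℚ` (else `π = B(¼,½)B(¾,½)/4` would be algebraic over `ℚ[B(¼,½)]`, against `chudnovsky_pi_beta`).
[cite: Chudnovsky1984, Ch. 7 §2 Corollary 2.3 (p. 307)] -/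
theorem legendre_algebraicIndependent :
    AlgebraicIndependent ℚ ![ProbabilityTheory.beta (((1 / 4 : ℚ)) : ℝ) (((1 / 2 : ℚ)) : ℝ),
      ProbabilityTheory.beta (((3 / 4 : ℚ)) : ℝ) (((1 / 2 : ℚ)) : ℝ)] := by
  set B : ℝ := ProbabilityTheory.beta (((1 / 4 : ℚ)) : ℝ) (((1 / 2 : ℚ)) : ℝ) with hB
  set B' : ℝ := ProbabilityTheory.beta (((3 / 4 : ℚ)) : ℝ) (((1 / 2 : ℚ)) : ℝ) with hB'
  have hBB' : B * B' = 4 * Real.pi := legendre_beta_mul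
  -- `![B, π]` is algebraically independent
  have h' : AlgebraicIndependent ℚ ![B, Real.pi] := by
    have h := chudnovsky_pi_beta.comp (Equiv.swap (0 : Fin 2) 1) (Equiv.injective _)
    convert h using 1
    funext i
    fin_cases i <;> rfl
  rw [AlgebraicIndependent.iff_transcendental_adjoin_image (1 : Fin 2)]
  constructor
  · -- the restricted family is `B` alone, a restriction of `![B, π]` too
    have h1 := h'.comp (fun j : {j : Fin 2 // j ≠ 1} => (j : Fin 2)) Subtype.val_injective
    convert h1 using 1
    funext j
    obtain ⟨j, hj⟩ := j
    fin_cases j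
    · rfl
    · exact absurd rfl hj
  · have himg : (![B, B'] : Fin 2 → ℝ) '' ({1}ᶜ : Set (Fin 2)) = {B} := by
      ext y
      simp only [Set.mem_image, Set.mem_compl_iff, Set.mem_singleton_iff]
      constructor
      · rintro ⟨j, hj, rfl⟩
        fin_cases j
        · rfl
        · exact absurd rfl hj
      · rintro rfl
        exact ⟨0, by decide, rfl⟩
    have himg' : (![B, Real.pi] : Fin 2 → ℝ) '' ({0} : Set (Fin 2)) = {B} := by
      ext y
      simp
    rw [himg]
    intro halg
    have hBmem : B ∈ Algebra.adjoin ℚ ({B} : Set ℝ) := Algebra.subset_adjoin rfl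
    have hBalg : IsAlgebraic (Algebra.adjoin ℚ ({B} : Set ℝ)) B :=
      isAlgebraic_algebraMap (⟨B, hBmem⟩ : Algebra.adjoin ℚ ({B} : Set ℝ))
    have hqmem : ((1 / 4 : ℚ) : ℝ) ∈ Algebra.adjoin ℚ ({B} : Set ℝ) := by
      simpa using Subalgebra.algebraMap_mem (Algebra.adjoin ℚ ({B} : Set ℝ)) (1 / 4 : ℚ)
    have hq : IsAlgebraic (Algebra.adjoin ℚ ({B} : Set ℝ)) ((1 / 4 : ℚ) : ℝ) :=
      isAlgebraic_algebraMap (⟨((1 / 4 : ℚ) : ℝ), hqmem⟩ : Algebra.adjoin ℚ ({B} : Set ℝ))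
    have hπ : IsAlgebraic (Algebra.adjoin ℚ ({B} : Set ℝ)) Real.pi := by
      have h := (hq.mul hBalg).mul halg
      have e : ((1 / 4 : ℚ) : ℝ) * B * (![B, B'] : Fin 2 → ℝ) 1 = Real.pi := by
        show ((1 / 4 : ℚ) : ℝ) * B * B' = Real.pi
        rw [mul_assoc, hBB']
        push_cast
        ring
      rw [e] at h
      exact h
    have htr := h'.transcendental_adjoin (s := ({0} : Set (Fin 2))) (i := 1) (by simp)
    rw [himg'] at htr
    exact htr hπ

/-! ## Legendre's relation inside the calculus -/

/-- **LEGENDRE'S RELATION IN `P`**: `⟦β(¼,½)⟧·⟦β(¾,½)⟧ = 16·⟦A⟧` for the arctangent carrier `A` (value bookkeeping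
`B(¼,½)B(¾,½) = 4π = 16·(π/4)`): Dirichlet's re-association `β(¼,½)β(¾,½) = β(½,½)β(¼,1)` (`betaClass_reassoc`),
`β(½,½) = ⟦[π]⟧` (`betaClass_half_half_eq_piRep`) `= ⟦open disc⟧` (null circle) `= ⟦[pt,4]⟧·⟦A⟧` (`stub_discClass`),
and `⟦[pt,¼]⟧·β(¼,1) = 1` (`toFormalPeriod_unit_constMul_mul_betaFirstOne`: one Newton–Leibniz move).
[cite: KontsevichZagier2001, §1.1] -/
theorem legendre_relation_P (A : KZ.IntegralRep 1) (hAd : A.domain = {t | t 0 ∈ Set.Ioo (0:ℝ) 1})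
    (hAi : Set.EqOn A.integrand (fun t => 1 / (1 + t 0 ^ 2)) A.domain) :
    Summit.KontsevichZagierPeriods.GammaHodgeSectorKO.betaClass (1 / 4) (1 / 2) *
        Summit.KontsevichZagierPeriods.GammaHodgeSectorKO.betaClass (3 / 4) (1 / 2) =
      16 * KZ.toFormalPeriod (KZ.of A) := by
  -- Dirichlet's re-association at `(¼, ½, ½)`
  have hdir := Summit.KontsevichZagierPeriods.TerasomaMultiplication.GammaHodgeFromRelators.betaClass_reassoc
    (1 / 4) (1 / 2) (1 / 2) (by norm_num) (by norm_num) (by norm_num)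
  rw [show (1 / 4 + 1 / 2 : ℚ) = 3 / 4 by norm_num, show (1 / 2 + 1 / 2 : ℚ) = 1 by norm_num] at hdir
  rw [hdir]
  -- `β(¼,1) = 4`
  have hq : IsAlgebraic ℚ (((1 / 4 : ℚ) : ℚ) : ℝ) := isAlgebraic_algebraMap _
  have hunit := Summit.KontsevichZagierPeriods.KontsevichZagierPeriods.Theorems.toFormalPeriod_unit_constMul_mul_betaFirstOne
    (1 / 4) (by norm_num)
    (Summit.KontsevichZagierPeriods.GammaHodgeSectorKO.betaRep (1 / 4) 1 (by norm_num) (by norm_num)) rfl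
    (fun x _ => rfl) hq
  have hβ1 : Summit.KontsevichZagierPeriods.GammaHodgeSectorKO.betaClass (1 / 4) 1 =
      KZ.toFormalPeriod (KZ.of (KZ.IntegralRep.unit.constMul ((4 : ℕ) : ℝ) (isAlgebraic_nat 4))) := by
    rw [Summit.KontsevichZagierPeriods.GammaHodgeSectorKO.betaClass_eq (1 / 4) 1 (by norm_num) (by norm_num)]
    have h4 : KZ.toFormalPeriod (KZ.of (KZ.IntegralRep.unit.constMul ((4 : ℕ) : ℝ) (isAlgebraic_nat 4))) *
        KZ.toFormalPeriod (KZ.of (KZ.IntegralRep.unit.constMul (((1 / 4 : ℚ) : ℚ) : ℝ) hq)) = 1 := by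
      rw [← lindemann_pt_mul, ← lindemann_pt_one]
      exact lindemann_pt_congr _ _ (by push_cast; norm_num)
    calc KZ.toFormalPeriod (KZ.of (Summit.KontsevichZagierPeriods.GammaHodgeSectorKO.betaRep (1 / 4) 1 _ _))
        = (KZ.toFormalPeriod (KZ.of (KZ.IntegralRep.unit.constMul ((4 : ℕ) : ℝ) (isAlgebraic_nat 4))) *
            KZ.toFormalPeriod (KZ.of (KZ.IntegralRep.unit.constMul (((1 / 4 : ℚ) : ℚ) : ℝ) hq))) *
          KZ.toFormalPeriod (KZ.of (Summit.KontsevichZagierPeriods.GammaHodgeSectorKO.betaRep (1 / 4) 1 _ _)) := by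
          rw [h4, one_mul]
      _ = KZ.toFormalPeriod (KZ.of (KZ.IntegralRep.unit.constMul ((4 : ℕ) : ℝ) (isAlgebraic_nat 4))) := by
          rw [mul_assoc, hunit, mul_one]
  -- `β(½,½) = ⟦[π]⟧ = ⟦[ℝ, 1/(1+x²)]⟧ = 4⟦[(0,1), 1/(1+x²)]⟧ = 4⟦A⟧`
  have hhalf := Summit.KontsevichZagierPeriods.TerasomaMultiplication.GammaHodgeFromRelators.betaClass_half_half_eq_piRep
  have hnorm : KZ.Equivalent
      (Summit.KontsevichZagierPeriods.MzvKernelInKZ.Negative.lineRep univ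
        Summit.KontsevichZagierPeriods.MzvKernelInKZ.Negative.sa_univ1) KZ.piRep :=
    (Summit.KontsevichZagierPeriods.CompiledSubstitutions.PiNormalisation.piNormalisation_proof KZ.piRep rfl
      (fun _ _ => rfl)).1 _ rfl (fun _ _ => rfl)
  have h4 := Summit.KontsevichZagierPeriods.MzvKernelInKZ.Negative.line_univ_sub_four_mem
  have hL01 : KZ.toFormalPeriod (KZ.of (Summit.KontsevichZagierPeriods.MzvKernelInKZ.Negative.lineRep
      Summit.KontsevichZagierPeriods.MzvKernelInKZ.Negative.L01
      Summit.KontsevichZagierPeriods.MzvKernelInKZ.Negative.sa_L01)) = KZ.toFormalPeriod (KZ.of A) :=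
    lindemann_arc_class_eq _ A rfl (fun _ _ => rfl) hAd hAi
  have hdisc : Summit.KontsevichZagierPeriods.GammaHodgeSectorKO.betaClass (1 / 2) (1 / 2) =
      4 * KZ.toFormalPeriod (KZ.of A) := by
    rw [hhalf, ← hnorm.toFormalPeriod_eq, KZ.toFormalPeriod_eq_iff.mpr h4, map_nsmul, hL01, nsmul_eq_mul,
      Nat.cast_ofNat]
  have hβ1' : Summit.KontsevichZagierPeriods.GammaHodgeSectorKO.betaClass (1 / 4) 1 = 4 := by
    rw [hβ1, KZ.toFormalPeriod_of_unit_constMul_natCast, Nat.cast_ofNat]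
  rw [hdisc, hβ1']
  ring

/-! ## The Legendre ring -/

/-- Classes of the pinned `β(¾,½)` carriers. [cite: KontsevichZagier2001, §1.1] -/
theorem legendre_beta34_class_eq (H : KZ.IntegralRep 1) (hHd : H.domain = {t | t 0 ∈ Set.Ioo (0:ℝ) 1})
    (hHi : Set.EqOn H.integrand
      (fun t => (t 0) ^ (((3 / 4 : ℚ) : ℝ) - 1) * (1 - t 0) ^ (((1 / 2 : ℚ) : ℝ) - 1)) H.domain) :
    KZ.toFormalPeriod (KZ.of H) = Summit.KontsevichZagierPeriods.GammaHodgeSectorKO.betaClass (3 / 4) (1 / 2) :=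
  Summit.KontsevichZagierPeriods.GammaHodgeSectorKO.IsBetaRep.toFormalPeriod_eq (by norm_num) (by norm_num)
    ⟨hHd, fun x hx => by rw [hHi hx]; rfl⟩

/-- **STUB `stub_legendreRing`: CONJECTURE 1 HOLDS ON THE LEGENDRE RING; ITS ONLY RELATION IS LEGENDRE'S.** On the subring
of the formal period ring generated by the algebraic points, the arctangent carriers `⟦[(0,1), 1/(1+t²)]⟧`, and Euler's Beta
carriers `⟦β(¼,½)⟧` and `⟦β(¾,½)⟧` (the two lemniscatic periods), `evalP x = 0 → x = 0`: writing `x = p(a, y, z)`,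
`X₀ − X₁X₂/16 ∣ p − p[X₀ ↦ X₁X₂/16]` is killed in `P` by LEGENDRE'S RELATION `yz = 16a` (`legendre_relation_P`, a chain
of moves), and `p[X₀ ↦ X₁X₂/16]`, a polynomial in `y, z` alone after the substitution, vanishes in `P` because its value
vanishes and `B(¼,½)`, `B(¾,½)` are algebraically independent (CHUDNOVSKY, `legendre_algebraicIndependent`).
[cite: Chudnovsky1984, Ch. 7 §2 Corollary 2.3 (p. 307)] [cite: KontsevichZagier2001, §1.2] -/
theorem stub_legendreRing :
    ∀ x ∈ Subring.closure
        ({p : KZ.FormalPeriodRing | ∃ (a : ℝ) (ha : IsAlgebraic ℚ a),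
            p = KZ.toFormalPeriod (KZ.of (KZ.IntegralRep.unit.constMul a ha))} ∪
          ({p : KZ.FormalPeriodRing | ∃ A : KZ.IntegralRep 1, A.domain = {t | t 0 ∈ Set.Ioo (0:ℝ) 1} ∧
            Set.EqOn A.integrand (fun t => 1 / (1 + t 0 ^ 2)) A.domain ∧ p = KZ.toFormalPeriod (KZ.of A)} ∪
          {p : KZ.FormalPeriodRing | ∃ H : KZ.IntegralRep 1, H.domain = {t | t 0 ∈ Set.Ioo (0:ℝ) 1} ∧
            Set.EqOn H.integrand (fun t => (t 0) ^ (((1 / 4 : ℚ) : ℝ) - 1) * (1 - t 0) ^ (((1 / 2 : ℚ) : ℝ) - 1))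
              H.domain ∧ p = KZ.toFormalPeriod (KZ.of H)} ∪
          {p : KZ.FormalPeriodRing | ∃ H : KZ.IntegralRep 1, H.domain = {t | t 0 ∈ Set.Ioo (0:ℝ) 1} ∧
            Set.EqOn H.integrand (fun t => (t 0) ^ (((3 / 4 : ℚ) : ℝ) - 1) * (1 - t 0) ^ (((1 / 2 : ℚ) : ℝ) - 1))
              H.domain ∧ p = KZ.toFormalPeriod (KZ.of H)})),
      KZ.evalP x = 0 → x = 0 := by
  intro x hx hx0
  obtain ⟨A₀, hA₀d, hA₀i⟩ := lindemann_exists_arc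
  -- names for the three classes and their values
  set a : KZ.FormalPeriodRing := KZ.toFormalPeriod (KZ.of A₀) with ha
  set y : KZ.FormalPeriodRing := Summit.KontsevichZagierPeriods.GammaHodgeSectorKO.betaClass (1 / 4) (1 / 2) with hy
  set z : KZ.FormalPeriodRing := Summit.KontsevichZagierPeriods.GammaHodgeSectorKO.betaClass (3 / 4) (1 / 2) with hz
  have hleg : y * z = 16 * a := legendre_relation_P A₀ hA₀d hA₀i
  -- the coefficient field and the point homomorphism
  let K := algebraicClosure ℚ ℝ
  haveI hKalg : Algebra.IsAlgebraic ℚ K := algebraicClosure.isAlgebraic ℚ ℝ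
  let φ : K →+* KZ.FormalPeriodRing :=
    { toFun := fun c => KZ.toFormalPeriod
        (KZ.of (KZ.IntegralRep.unit.constMul (c : ℝ) ((mem_algebraicClosure_iff).mp c.2)))
      map_one' := (lindemann_pt_congr _ isAlgebraic_one (by simp)).trans lindemann_pt_one
      map_mul' := fun c d =>
        (lindemann_pt_congr _ (((mem_algebraicClosure_iff).mp c.2).mul
          ((mem_algebraicClosure_iff).mp d.2)) (by push_cast; rfl)).trans (lindemann_pt_mul _ _)
      map_zero' := (lindemann_pt_congr _ isAlgebraic_zero (by simp)).trans lindemann_pt_zero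
      map_add' := fun c d =>
        (lindemann_pt_congr _ (((mem_algebraicClosure_iff).mp c.2).add
          ((mem_algebraicClosure_iff).mp d.2)) (by push_cast; rfl)).trans (lindemann_pt_add _ _) }
  have hφ : ∀ c : K, KZ.evalP (φ c) = (c : ℝ) := fun c => lindemann_evalP_pt _
  have hcomp : KZ.evalP.comp φ = algebraMap K ℝ := by
    ext c
    rw [RingHom.comp_apply, hφ]
    rfl
  -- every generator is a polynomial in `a, y, z`
  let t : Fin 3 → KZ.FormalPeriodRing := ![a, y, z]
  let F : MvPolynomial (Fin 3) K →+* KZ.FormalPeriodRing := MvPolynomial.eval₂Hom φ t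
  have hle : Subring.closure
      ({p : KZ.FormalPeriodRing | ∃ (a : ℝ) (ha : IsAlgebraic ℚ a),
          p = KZ.toFormalPeriod (KZ.of (KZ.IntegralRep.unit.constMul a ha))} ∪
        ({p : KZ.FormalPeriodRing | ∃ A : KZ.IntegralRep 1, A.domain = {t | t 0 ∈ Set.Ioo (0:ℝ) 1} ∧
          Set.EqOn A.integrand (fun t => 1 / (1 + t 0 ^ 2)) A.domain ∧ p = KZ.toFormalPeriod (KZ.of A)} ∪
        {p : KZ.FormalPeriodRing | ∃ H : KZ.IntegralRep 1, H.domain = {t | t 0 ∈ Set.Ioo (0:ℝ) 1} ∧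
          Set.EqOn H.integrand (fun t => (t 0) ^ (((1 / 4 : ℚ) : ℝ) - 1) * (1 - t 0) ^ (((1 / 2 : ℚ) : ℝ) - 1))
            H.domain ∧ p = KZ.toFormalPeriod (KZ.of H)} ∪
        {p : KZ.FormalPeriodRing | ∃ H : KZ.IntegralRep 1, H.domain = {t | t 0 ∈ Set.Ioo (0:ℝ) 1} ∧
          Set.EqOn H.integrand (fun t => (t 0) ^ (((3 / 4 : ℚ) : ℝ) - 1) * (1 - t 0) ^ (((1 / 2 : ℚ) : ℝ) - 1))
            H.domain ∧ p = KZ.toFormalPeriod (KZ.of H)})) ≤ F.range := by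
    refine (Subring.closure_le).mpr ?_
    rintro q (⟨c, hc, rfl⟩ | ((⟨A, hAd, hAi, rfl⟩ | ⟨H, hHd, hHi, rfl⟩) | ⟨H, hHd, hHi, rfl⟩))
    · refine ⟨MvPolynomial.C (⟨c, (mem_algebraicClosure_iff).mpr hc⟩ : K), ?_⟩
      rw [MvPolynomial.eval₂Hom_C]
      rfl
    · exact ⟨MvPolynomial.X 0, (MvPolynomial.eval₂Hom_X' φ t 0).trans (lindemann_arc_class_eq A₀ A hA₀d hA₀i hAd hAi)⟩
    · exact ⟨MvPolynomial.X 1, (MvPolynomial.eval₂Hom_X' φ t 1).trans (chudnovsky_beta_class_eq H hHd hHi).symm⟩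
    · exact ⟨MvPolynomial.X 2, (MvPolynomial.eval₂Hom_X' φ t 2).trans (legendre_beta34_class_eq H hHd hHi).symm⟩
  obtain ⟨p, rfl⟩ := hle hx
  -- the substitution `X₀ ↦ X₁X₂/16`
  let w : Fin 3 → MvPolynomial (Fin 3) K := ![MvPolynomial.C (1 / 16 : K) * MvPolynomial.X 1 * MvPolynomial.X 2,
    MvPolynomial.X 1, MvPolynomial.X 2]
  have hw : ∀ i, i ≠ (0 : Fin 3) → w i = MvPolynomial.X i := by
    intro i hi
    fin_cases i
    · exact absurd rfl hi
    · rfl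
    · rfl
  obtain ⟨q, hq⟩ := legendre_dvd_sub_bind₁ (0 : Fin 3) w hw p
  -- `F (X₀ − w₀) = a − (1/16)·y·z = 0` by Legendre
  have h16 : φ (1 / 16 : K) * 16 = 1 := by
    rw [← map_ofNat φ 16, ← map_mul, show (1 / 16 : K) * 16 = 1 by norm_num, map_one]
  have hkill : F (MvPolynomial.X 0 - w 0) = 0 := by
    show F (MvPolynomial.X 0 - MvPolynomial.C (1 / 16 : K) * MvPolynomial.X 1 * MvPolynomial.X 2) = 0
    rw [map_sub, map_mul, map_mul, MvPolynomial.eval₂Hom_X', MvPolynomial.eval₂Hom_X', MvPolynomial.eval₂Hom_X',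
      MvPolynomial.eval₂Hom_C]
    show a - φ (1 / 16 : K) * y * z = 0
    rw [mul_assoc, hleg, ← mul_assoc, h16, one_mul, sub_self]
  have hsub : F p = F (MvPolynomial.bind₁ w p) := by
    have h := congrArg F hq
    rw [map_sub, map_mul, hkill, zero_mul, sub_eq_zero] at h
    exact h
  -- `F (p[w]) = G (θ p)` with `G` the evaluation at `(y, z)` and `θ` the elimination of `X₀`
  let u : Fin 2 → KZ.FormalPeriodRing := ![y, z]
  let G : MvPolynomial (Fin 2) K →+* KZ.FormalPeriodRing := MvPolynomial.eval₂Hom φ u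
  let θ : MvPolynomial (Fin 3) K →ₐ[K] MvPolynomial (Fin 2) K := MvPolynomial.aeval
    ![MvPolynomial.C (1 / 16 : K) * MvPolynomial.X 0 * MvPolynomial.X 1, MvPolynomial.X 0, MvPolynomial.X 1]
  have hFG : F (MvPolynomial.bind₁ w p) = G (θ p) := by
    have h1 : F (MvPolynomial.bind₁ w p) = MvPolynomial.eval₂Hom φ (fun i => F (w i)) p :=
      MvPolynomial.eval₂Hom_bind₁ φ t w p
    have h2 : G (θ p) = MvPolynomial.eval₂Hom φ (fun i => G (![MvPolynomial.C (1 / 16 : K) * MvPolynomial.X 0 *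
        MvPolynomial.X 1, MvPolynomial.X 0, MvPolynomial.X 1] i)) p := by
      show G (MvPolynomial.bind₁ _ p) = _
      exact MvPolynomial.eval₂Hom_bind₁ φ u _ p
    have hfg : (fun i => F (w i)) = (fun i => G (![MvPolynomial.C (1 / 16 : K) * MvPolynomial.X 0 *
        MvPolynomial.X 1, MvPolynomial.X 0, MvPolynomial.X 1] i)) := by
      funext i
      fin_cases i
      · show F (MvPolynomial.C (1 / 16 : K) * MvPolynomial.X 1 * MvPolynomial.X 2) =
          G (MvPolynomial.C (1 / 16 : K) * MvPolynomial.X 0 * MvPolynomial.X 1)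
        simp only [F, G, map_mul, MvPolynomial.eval₂Hom_C, MvPolynomial.eval₂Hom_X']
        rfl
      · show F (MvPolynomial.X 1) = G (MvPolynomial.X 0)
        rw [MvPolynomial.eval₂Hom_X', MvPolynomial.eval₂Hom_X']
        rfl
      · show F (MvPolynomial.X 2) = G (MvPolynomial.X 1)
        rw [MvPolynomial.eval₂Hom_X', MvPolynomial.eval₂Hom_X']
        rfl
    rw [h1, h2, hfg]
  -- values: `evalP (G r) = r(B(¼,½), B(¾,½))`
  have hu : (fun i => KZ.evalP (u i)) = ![ProbabilityTheory.beta (((1 / 4 : ℚ)) : ℝ) (((1 / 2 : ℚ)) : ℝ),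
      ProbabilityTheory.beta (((3 / 4 : ℚ)) : ℝ) (((1 / 2 : ℚ)) : ℝ)] := by
    funext i
    fin_cases i
    · exact Summit.KontsevichZagierPeriods.GammaHodgeSectorKO.evalP_betaClass (1 / 4) (1 / 2) (by norm_num) (by norm_num)
    · exact Summit.KontsevichZagierPeriods.GammaHodgeSectorKO.evalP_betaClass (3 / 4) (1 / 2) (by norm_num) (by norm_num)
  have hGval : ∀ r : MvPolynomial (Fin 2) K, KZ.evalP (G r) = MvPolynomial.aeval (fun i => KZ.evalP (u i)) r := by
    intro r
    show KZ.evalP (MvPolynomial.eval₂Hom φ u r) = _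
    rw [MvPolynomial.coe_eval₂Hom, MvPolynomial.eval₂_comp_left, hcomp, MvPolynomial.aeval_def]
    rfl
  have hind : AlgebraicIndependent K (fun i => KZ.evalP (u i)) := by
    rw [hu]
    exact legendre_algebraicIndependent.extendScalars K
  have hθ0 : θ p = 0 := by
    refine hind.eq_zero_of_aeval_eq_zero _ ?_
    rw [← hGval, ← hFG, ← hsub]
    exact hx0
  rw [hsub, hFG, hθ0, map_zero]

/-- **THE LEGENDRE RING IS A CLOSED SECTOR OF THE RESIDUE.** [cite: KontsevichZagier2001, §1.2] -/
theorem legendreRing_inf_ker_le_relations :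
    KZ.eval.ker ⊓ (Subring.closure
        ({p : KZ.FormalPeriodRing | ∃ (a : ℝ) (ha : IsAlgebraic ℚ a),
            p = KZ.toFormalPeriod (KZ.of (KZ.IntegralRep.unit.constMul a ha))} ∪
          ({p : KZ.FormalPeriodRing | ∃ A : KZ.IntegralRep 1, A.domain = {t | t 0 ∈ Set.Ioo (0:ℝ) 1} ∧
            Set.EqOn A.integrand (fun t => 1 / (1 + t 0 ^ 2)) A.domain ∧ p = KZ.toFormalPeriod (KZ.of A)} ∪
          {p : KZ.FormalPeriodRing | ∃ H : KZ.IntegralRep 1, H.domain = {t | t 0 ∈ Set.Ioo (0:ℝ) 1} ∧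
            Set.EqOn H.integrand (fun t => (t 0) ^ (((1 / 4 : ℚ) : ℝ) - 1) * (1 - t 0) ^ (((1 / 2 : ℚ) : ℝ) - 1))
              H.domain ∧ p = KZ.toFormalPeriod (KZ.of H)} ∪
          {p : KZ.FormalPeriodRing | ∃ H : KZ.IntegralRep 1, H.domain = {t | t 0 ∈ Set.Ioo (0:ℝ) 1} ∧
            Set.EqOn H.integrand (fun t => (t 0) ^ (((3 / 4 : ℚ) : ℝ) - 1) * (1 - t 0) ^ (((1 / 2 : ℚ) : ℝ) - 1))
              H.domain ∧ p = KZ.toFormalPeriod (KZ.of H)}))).toAddSubgroup.comap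
        KZ.toFormalPeriod.toAddMonoidHom ≤ KZ.relations := by
  rintro c ⟨hc, hS⟩
  have hc0 : KZ.eval c = 0 := hc
  exact KZ.toFormalPeriod_eq_zero_iff.mp
    (stub_legendreRing _ hS (by rw [KZ.evalP_toFormalPeriod, hc0]))

end Summit.KontsevichZagierPeriods.HyperbolicBloch.OffTetraSectorKernel

end
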